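import Summits.HodgeConjecture.CorCM.CMProductSimpleFactors
import Summits.HodgeConjecture.CorCM.CMSliceDegreeLeFour
import Summits.HodgeConjecture.CorCM.CMFivefoldsOfMarkman
import HarnessLib

/-!
# COR-CM: where the open content of `HC_CM` begins, GIVEN MARKMAN'S FOURFOLD THEOREM — Galois CM fields of
# degree `≥ 8`, CM dimension `≥ 6` (kernel form of «the first new content is `[F:ℚ] = 8`»)

Cell `pub-hodgecm2` (COR-CM = stage 2 of the Hodge ladder), seat lit-andre-3 gen 12 (2026-08-21), own count-neutral
lane (no row of `HOME/BINDER-OWNERS.md`): theorems only — no definition, no named fact, no `sorry`; nothing under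
`CorCM/B01/`, `Assembly/`, `Transposition/` is touched and `HC_CM` is NOT proved.  Sibling of
`CorCM/CMSliceExhaustion` (seat b24: `HC_CM ⟺` its slices `HodgeConjectureFor (∏_j A_{(F,Θ_j)})` at the CM fields `F`
Galois over `ℚ` of degree `≥ 6`) in the genre of `CorCM/Stage4OpenSlices` (the open content of a target delimited
in the kernel).

WHAT IS RECORDED.  The tree decides, modulo the ONE displayed named fact
`HodgeTheory.Markman2025_weilClasses_algebraic_abelianFourfold` (E. Markman, Weil classes on abelian FOURFOLDS of Weil
type, arXiv:2502.03415 / the survey arXiv:2509.23403 Thm. 1.2 — unrefereed, typed as a record, not proved in the tree),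
every slice of `HC_CM` below degree `8` and every CM abelian variety below dimension `6`:
* degree `≤ 4`: `QuarticCM.hodgeConjectureFor_cmProdAV_of_finrank_le_four` (seat b24; UNCONDITIONAL);
* degree `6`, Galois (a Galois sextic CM field is cyclic): `CyclicSextic.cmAbelianHodge_slice_sextic_of_markman`
  (seat b30's rung, given Markman's fourfold theorem only);
* dimension `≤ 5`: `CMWeights.hodgeConjectureFor_of_isOfCMType_dim_le_five_of_markman` (seat b27/b24 lineage, after
  Moonen–Zarhin 1999, given Markman's fourfold theorem only).
Since a CM field has even degree (`even_finrank`: totally complex, `[F:ℚ] = 2 · #{complex places}`), a Galois CM field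
of degree in `[6, 8)` has degree `6`, and the exhaustion theorems of `CMSliceExhaustion` sharpen, GIVEN MARKMAN, to:

* `hc_cm_iff_forall_galois_cmProdAV_eight_le_of_markman` — **`HC_CM ⟺` the Hodge conjecture for every
  `∏_j A_{(F,Θ_j)}` over every CM field `F` GALOIS over `ℚ` with `8 ≤ [F:ℚ]`**;
* `hc_cm_iff_forall_galois_cmProdAV_eight_le_six_le_dim_of_markman` — the same restricted further to the products of
  DIMENSION `≥ 6` (so: at least two factors, or one factor over a field of degree `≥ 12`);
* `hc_cm_iff_forall_six_le_dim_of_markman` — the dimension form alone: `HC_CM ⟺` Milne's hypothesis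
  `CMHodgeHypothesisAt A` for the complex abelian varieties `A` with `6 ≤ dim A`;
* `hc_cm_iff_forall_galois_powSucc_eight_le_of_markman` — ONE abelian variety per Galois CM field of degree `≥ 8`
  (all powers of `P_F = ∏_i A_{(F,Θ₀ i)}`, `Θ₀` any enumeration of the CM types of `F`);
* `hc_cm_iff_forall_galois_binderSlice_eight_le_of_markman` — the binder-language form (the two binders of
  `CMAbelianHodge` VERBATIM plus «simple abelian subvarieties have `End⁰ →+* F`»), Galois `F` of degree `≥ 8`;
* `hc_cm_iff_forall_galois_cmProdAV_over_eight_le_of_markman` — the cofinal form: for any CM field `F₀`, only the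
  Galois CM fields of degree `≥ 8` receiving `F₀` matter.

Neither side of any equivalence is asserted.  By degree, the first slices not decided by tree theorems modulo
Markman's fourfold theorem are those of the Galois CM fields of degree `8` (Galois group of order `8` with the
complex conjugation central: `ℤ/8`, `ℤ/4 × ℤ/2` (two conjugacy placements of `c`), `(ℤ/2)³`, `D₄`, `Q₈` — the rows of
the cell's octic census `CorCM/Census/Octic*`); by dimension, CM abelian varieties of dimension `6`.
HONEST SCOPE: «decided modulo Markman» is an implication FROM the named fact; the tree proves neither the fact nor any
slice of degree `≥ 8` / dimension `≥ 6` in general (particular degree-`8`/`10` sub-slices are tree theorems modulo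
Markman's SIXFOLD record or modulo face-period witnesses: `Census/OcticCurveFourfold*`, `Census/DecicFaceTransport*`,
`FaceCensusOrbitCover`, cited by name only).

## References
* [Markman2025SurveySecant] E. Markman, *Secant sheaves and Weil classes on abelian varieties*, arXiv:2509.23403
  (2025), Thm. 1.2 and Cor. 1.3 (the displayed hypothesis; unrefereed).
* [MoonenZarhin1999LowDim] B. Moonen, Yu. Zarhin, Math. Ann. 315 (1999) 711–733, Thms. (0.1)–(0.2) (dimension `≤ 5`).
* [Milne2020HodgeClassesAV] J. S. Milne, *Hodge classes on abelian varieties* (2020), proof of Thm. 1 (reduction to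
  products `∏ A_Φ` over one Galois CM field).
* [Shimura1998] G. Shimura, *Abelian Varieties with Complex Multiplication and Modular Functions* (1998), §6.2 Thm. 3,
  §18.2 Lemma (ii)–(iii).
* [Andre1992HodgeCM] Y. André, Progr. Math. 102 (1992), Théorème (pp. 4–5).
-/

noncomputable section

open CategoryTheory NumberField AlgebraicGeometry
open Literature.AlgebraicGeometry Literature.AlgebraicGeometry.Motives Literature.AlgebraicGeometry.HodgeTheory
open Literature.AlgebraicGeometry.Milne1999
open Literature.NumberTheory.Automorphic.PicardCM (CMAbelianVarietyRealised)
open Summit.HodgeConjecture.CorCM.Domination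

namespace Summit.HodgeConjecture.CorCM.SliceExhaustion

/-! ## §1 Degrees of CM fields: even; Galois and in `[6, 8)` means `6` -/

section Degree

variable (F : Type) [Field F] [NumberField F] [IsCMField F]

/-- A CM field has even degree: it is totally complex, so `[F:ℚ] = 2 · #{complex places}`. [folklore] -/
theorem even_finrank : Even (Module.finrank ℚ F) :=
  ⟨InfinitePlace.nrComplexPlaces F, by rw [IsTotallyComplex.finrank F]; ring⟩

variable {F}

/-- A CM field of degree `≥ 6` and `< 8` has degree `6`. [folklore] -/
theorem finrank_eq_six_of_six_le_of_lt_eight (h6 : 6 ≤ Module.finrank ℚ F) (h8 : Module.finrank ℚ F < 8) :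
    Module.finrank ℚ F = 6 := by
  obtain ⟨r, hr⟩ := even_finrank F
  omega

/-- A CM field of degree `< 8` has degree `≤ 4` or degree `6`. [folklore] -/
theorem finrank_le_four_or_eq_six_of_lt_eight (h8 : Module.finrank ℚ F < 8) :
    Module.finrank ℚ F ≤ 4 ∨ Module.finrank ℚ F = 6 := by
  obtain ⟨r, hr⟩ := even_finrank F
  omega

end Degree

/-! ## §2 Every slice below degree `8` at a Galois CM field is a tree theorem modulo Markman's fourfold theorem -/

section BelowEight

variable {F : Type} [Field F] [NumberField F] [IsCMField F]

/-- **The Galois sextic slice, `cmProdAV` form, given Markman's fourfold theorem**: for `F` Galois over `ℚ` with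
`[F:ℚ] = 6`, HC for every `∏_j A_{(F,Θ_j)}` — seat b30's binder-language slice
`CyclicSextic.cmAbelianHodge_slice_sextic_of_markman` read back on the products (`forall_cmProdAV_of_binderSlice`).
[cite: Markman2025SurveySecant, Thm. 1.2] [cite: Andre1992HodgeCM, Théorème (pp. 4–5)] -/
theorem hodgeConjectureFor_cmProdAV_of_isGalois_of_finrank_eq_six_of_markman [IsGalois ℚ F]
    (hW4 : Markman2025_weilClasses_algebraic_abelianFourfold) (h6 : Module.finrank ℚ F = 6)
    (h₃ : CMAbelianVarietyRealised) (n : ℕ) (Θ : Fin (n + 1) → CMType F) :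
    HodgeConjectureFor (cmProdAV F h₃ n Θ).dim (cmProdAV F h₃ n Θ).X :=
  forall_cmProdAV_of_binderSlice h₃ (CyclicSextic.cmAbelianHodge_slice_sextic_of_markman hW4 h6) n Θ

/-- **Every slice at a Galois CM field of degree `< 8` is decided, given Markman's fourfold theorem**: degree `≤ 4`
unconditionally (`QuarticCM.hodgeConjectureFor_cmProdAV_of_finrank_le_four`), degree `6` by the sextic rung.
[cite: Markman2025SurveySecant, Thm. 1.2] [cite: MoonenZarhin1999LowDim, Thm. (0.1)] -/
theorem hodgeConjectureFor_cmProdAV_of_isGalois_of_finrank_lt_eight_of_markman [IsGalois ℚ F]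
    (hW4 : Markman2025_weilClasses_algebraic_abelianFourfold) (h8 : Module.finrank ℚ F < 8)
    (h₃ : CMAbelianVarietyRealised) (n : ℕ) (Θ : Fin (n + 1) → CMType F) :
    HodgeConjectureFor (cmProdAV F h₃ n Θ).dim (cmProdAV F h₃ n Θ).X := by
  rcases finrank_le_four_or_eq_six_of_lt_eight h8 with h4 | h6
  · exact QuarticCM.hodgeConjectureFor_cmProdAV_of_finrank_le_four h₃ h4 n Θ
  · exact hodgeConjectureFor_cmProdAV_of_isGalois_of_finrank_eq_six_of_markman hW4 h6 h₃ n Θ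

/-- **Every `∏_j A_{(F,Θ_j)}` of dimension `≤ 5` is decided, given Markman's fourfold theorem** (any CM field `F`):
the product is of CM type (`isOfCMType_cmProdAV`), so `CMWeights.hodgeConjectureFor_of_isOfCMType_dim_le_five_of_markman`
applies. [cite: MoonenZarhin1999LowDim, Thms. (0.1)–(0.2)] [cite: Markman2025SurveySecant, §1.1 and Cor. 1.3] -/
theorem hodgeConjectureFor_cmProdAV_of_dim_le_five_of_markman
    (hW4 : Markman2025_weilClasses_algebraic_abelianFourfold) (h₃ : CMAbelianVarietyRealised) (n : ℕ)
    (Θ : Fin (n + 1) → CMType F) (h5 : (cmProdAV F h₃ n Θ).dim ≤ 5) :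
    HodgeConjectureFor (cmProdAV F h₃ n Θ).dim (cmProdAV F h₃ n Θ).X :=
  CMWeights.hodgeConjectureFor_of_isOfCMType_dim_le_five_of_markman hW4 _ (isOfCMType_cmProdAV h₃ n Θ) h5

end BelowEight

/-! ## §3 `HC_CM` ⟺ its Galois slices of degree `≥ 8`, given Markman's fourfold theorem -/

/-- **`HC_CM` from its Galois slices of degree `≥ 8`, given Markman's fourfold theorem.**  If for every CM field `F`
Galois over `ℚ` with `8 ≤ [F:ℚ]` and every finite family `Θ` of CM types of `F` the product `∏_j A_{(F,Θ_j)}`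
satisfies the Hodge conjecture, then `HC_CM`: the slices of degree in `[6,8)` demanded by
`hc_cm_of_forall_galois_cmProdAV` are of degree `6` and are supplied by the sextic rung.
[cite: Milne2020HodgeClassesAV, proof of Theorem 1] [cite: Markman2025SurveySecant, Thm. 1.2] -/
theorem hc_cm_of_forall_galois_cmProdAV_eight_le_of_markman
    (hW4 : Markman2025_weilClasses_algebraic_abelianFourfold) (h₃ : CMAbelianVarietyRealised)
    (h : ∀ (F : Type) [Field F] [NumberField F] [IsCMField F], IsGalois ℚ F → 8 ≤ Module.finrank ℚ F →
      ∀ (n : ℕ) (Θ : Fin (n + 1) → CMType F), HodgeConjectureFor (cmProdAV F h₃ n Θ).dim (cmProdAV F h₃ n Θ).X) :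
    HC_CM := by
  refine hc_cm_of_forall_galois_cmProdAV h₃ fun F _ _ _ hG _ n Θ => ?_
  by_cases h8 : 8 ≤ Module.finrank ℚ F
  · exact h F hG h8 n Θ
  · haveI := hG
    exact hodgeConjectureFor_cmProdAV_of_isGalois_of_finrank_lt_eight_of_markman hW4 (by omega) h₃ n Θ

/-- **`HC_CM` ⟺ its Galois-CM-field slices of degree `≥ 8`, given Markman's fourfold theorem**: the Hodge conjecture
for complex abelian varieties of CM type is EQUIVALENT — granted
`Markman2025_weilClasses_algebraic_abelianFourfold` — to the Hodge conjecture for the products `∏_j A_{(F,Θ_j)}` of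
chosen realisations of CM types of one CM field `F`, `F` ranging over the CM fields Galois over `ℚ` of degree `≥ 8`.
Neither side is asserted. [cite: Milne2020HodgeClassesAV, proof of Theorem 1] [cite: Markman2025SurveySecant, Thm. 1.2] -/
theorem hc_cm_iff_forall_galois_cmProdAV_eight_le_of_markman
    (hW4 : Markman2025_weilClasses_algebraic_abelianFourfold) (h₃ : CMAbelianVarietyRealised) :
    HC_CM ↔ ∀ (F : Type) [Field F] [NumberField F] [IsCMField F], IsGalois ℚ F → 8 ≤ Module.finrank ℚ F →
      ∀ (n : ℕ) (Θ : Fin (n + 1) → CMType F), HodgeConjectureFor (cmProdAV F h₃ n Θ).dim (cmProdAV F h₃ n Θ).X :=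
  ⟨fun h _ _ _ _ _ _ n Θ => hodgeConjectureFor_cmProdAV_of_hc_cm h h₃ n Θ,
    hc_cm_of_forall_galois_cmProdAV_eight_le_of_markman hW4 h₃⟩

/-- **`HC_CM` ⟺ the products of DIMENSION `≥ 6` over the Galois CM fields of degree `≥ 8`, given Markman's fourfold
theorem** — both sharpenings at once: a product `∏_j A_{(F,Θ_j)}` of dimension `≤ 5` is decided by the dimension-`≤ 5`
theorem, so only the products of dimension `≥ 6` (two or more factors, each of dimension `[F:ℚ]/2 ≥ 4`; or one factor
with `[F:ℚ] ≥ 12`) carry open content. Neither side is asserted.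
[cite: MoonenZarhin1999LowDim, Thms. (0.1)–(0.2)] [cite: Markman2025SurveySecant, Thm. 1.2 and Cor. 1.3] -/
theorem hc_cm_iff_forall_galois_cmProdAV_eight_le_six_le_dim_of_markman
    (hW4 : Markman2025_weilClasses_algebraic_abelianFourfold) (h₃ : CMAbelianVarietyRealised) :
    HC_CM ↔ ∀ (F : Type) [Field F] [NumberField F] [IsCMField F], IsGalois ℚ F → 8 ≤ Module.finrank ℚ F →
      ∀ (n : ℕ) (Θ : Fin (n + 1) → CMType F), 6 ≤ (cmProdAV F h₃ n Θ).dim →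
        HodgeConjectureFor (cmProdAV F h₃ n Θ).dim (cmProdAV F h₃ n Θ).X := by
  refine ⟨fun h _ _ _ _ _ _ n Θ _ => hodgeConjectureFor_cmProdAV_of_hc_cm h h₃ n Θ, fun h => ?_⟩
  refine hc_cm_of_forall_galois_cmProdAV_eight_le_of_markman hW4 h₃ fun F _ _ _ hG h8 n Θ => ?_
  by_cases h6 : 6 ≤ (cmProdAV F h₃ n Θ).dim
  · exact h F hG h8 n Θ h6
  · exact hodgeConjectureFor_cmProdAV_of_dim_le_five_of_markman hW4 h₃ n Θ (by omega)

/-- **The dimension form: `HC_CM` ⟺ Milne's hypothesis at the complex abelian varieties of dimension `≥ 6`, given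
Markman's fourfold theorem** (`HC_CM` is definitionally `∀ A, CMHodgeHypothesisAt A`, `Interfaces.lean`; dimension
`≤ 5` is `CMWeights.cmHodgeHypothesisAt_of_dim_le_five_of_markman`). Neither side is asserted.
[cite: MoonenZarhin1999LowDim, Thms. (0.1)–(0.2)] [cite: Markman2025SurveySecant, §1.1 and Cor. 1.3] -/
theorem hc_cm_iff_forall_six_le_dim_of_markman (hW4 : Markman2025_weilClasses_algebraic_abelianFourfold) :
    HC_CM ↔ ∀ A : AbelianVariety ℂ, 6 ≤ A.dim → CMHodgeHypothesisAt A := by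
  rw [hc_cm_iff_forall_cmHodgeHypothesisAt]
  refine ⟨fun h A _ => h A, fun h A => ?_⟩
  by_cases h6 : 6 ≤ A.dim
  · exact h A h6
  · exact CMWeights.cmHodgeHypothesisAt_of_dim_le_five_of_markman hW4 A (by omega)

/-! ## §4 One abelian variety per field; the binder language; cofinality — all at degree `≥ 8`, given Markman -/

/-- **`HC_CM` ⟺ one abelian variety per Galois CM field of degree `≥ 8`, given Markman's fourfold theorem**: for every
CM field `F` Galois over `ℚ` with `8 ≤ [F:ℚ]` and every enumeration `Θ₀` of its CM types, the Hodge conjecture for all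
powers `P_F^{k+1}` of `P_F = ∏_i A_{(F,Θ₀ i)}`. Neither side is asserted.
[cite: MumfordAV1970, §19 Thm. 1 and p. 169] [cite: Markman2025SurveySecant, Thm. 1.2] -/
theorem hc_cm_iff_forall_galois_powSucc_eight_le_of_markman
    (hW4 : Markman2025_weilClasses_algebraic_abelianFourfold) (h₃ : CMAbelianVarietyRealised) :
    HC_CM ↔ ∀ (F : Type) [Field F] [NumberField F] [IsCMField F], IsGalois ℚ F → 8 ≤ Module.finrank ℚ F →
      ∀ (N : ℕ) (Θ₀ : Fin (N + 1) → CMType F), Function.Surjective Θ₀ →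
        ∀ k : ℕ, HodgeConjectureFor ((cmProdAV F h₃ N Θ₀).powSucc k).dim ((cmProdAV F h₃ N Θ₀).powSucc k).X := by
  rw [hc_cm_iff_forall_galois_cmProdAV_eight_le_of_markman hW4 h₃]
  refine ⟨fun h F _ _ _ hG h8 N Θ₀ hΘ₀ => (forall_cmProdAV_iff_forall_powSucc_of_surjective h₃ hΘ₀).1 (h F hG h8),
    fun h F _ _ _ hG h8 => ?_⟩
  obtain ⟨N, Θ₀, hΘ₀⟩ := exists_surjective_cmType F
  exact (forall_cmProdAV_iff_forall_powSucc_of_surjective h₃ hΘ₀).2 (h F hG h8 N Θ₀ hΘ₀)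

/-- **`HC_CM` ⟺ its binder-language slices at the Galois CM fields of degree `≥ 8`, given Markman's fourfold theorem**:
the two binders of `CMAbelianHodge` VERBATIM (`IsSmoothProjective A.dim A.X`, `∃ S : Subalgebra ℚ A.endAlgebra,
IsReduced S ∧ S commutative ∧ finrank ℚ S = 2 · dim A`) plus «simple abelian subvarieties of positive dimension have
`End⁰ →+* F`», for `F` Galois over `ℚ` with `8 ≤ [F:ℚ]` (`binderSlice_iff_forall_cmProdAV` at each `F`). Neither side
is asserted. [cite: Shimura1998, §6.2 Theorem 3 and §8.2 Proposition 26] [cite: Markman2025SurveySecant, Thm. 1.2] -/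
theorem hc_cm_iff_forall_galois_binderSlice_eight_le_of_markman
    (hW4 : Markman2025_weilClasses_algebraic_abelianFourfold) :
    HC_CM ↔ ∀ (F : Type) [Field F] [NumberField F] [IsCMField F], IsGalois ℚ F → 8 ≤ Module.finrank ℚ F →
      ∀ A : AbelianVariety ℂ, IsSmoothProjective A.dim A.X →
        (∃ S : Subalgebra ℚ A.endAlgebra,
          IsReduced ↥S ∧ (∀ x ∈ S, ∀ y ∈ S, x * y = y * x) ∧ Module.finrank ℚ ↥S = 2 * A.dim) →
        (∀ (B : AbelianVariety ℂ) (f : B ⟶ A), IsClosedImmersion (AbelianVariety.Hom.toSchemeHom f) →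
          AbelianVariety.IsSimple B → 0 < B.dim → Nonempty (B.endAlgebra →+* F)) →
        HodgeConjectureFor A.dim A.X := by
  rw [hc_cm_iff_forall_galois_cmProdAV_eight_le_of_markman hW4 cmAbelianVarietyRealised_holds]
  exact ⟨fun h F _ _ _ hG h8 => binderSlice_iff_forall_cmProdAV.2 (h F hG h8),
    fun h F _ _ _ hG h8 => binderSlice_iff_forall_cmProdAV.1 (h F hG h8)⟩

/-- **The cofinal form at degree `≥ 8`, given Markman's fourfold theorem**: for ANY CM field `F₀`, `HC_CM ⟺` the slices
at the CM fields `F` Galois over `ℚ`, of degree `≥ 8`, receiving `F₀` (`Nonempty (F₀ →+* F)`).  From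
`hc_cm_iff_forall_galois_cmProdAV_over`: a Galois CM field over `F₀` of degree `< 8` is decided by §2. Neither side is
asserted. [cite: Shimura1998, §6.2 Theorem 3 and §18.2 Lemma (ii)–(iii)] [cite: Markman2025SurveySecant, Thm. 1.2] -/
theorem hc_cm_iff_forall_galois_cmProdAV_over_eight_le_of_markman (F₀ : Type) [Field F₀] [NumberField F₀]
    [IsCMField F₀] (hW4 : Markman2025_weilClasses_algebraic_abelianFourfold) (h₃ : CMAbelianVarietyRealised) :
    HC_CM ↔ ∀ (F : Type) [Field F] [NumberField F] [IsCMField F], IsGalois ℚ F → Nonempty (F₀ →+* F) →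
      8 ≤ Module.finrank ℚ F →
      ∀ (n : ℕ) (Θ : Fin (n + 1) → CMType F), HodgeConjectureFor (cmProdAV F h₃ n Θ).dim (cmProdAV F h₃ n Θ).X := by
  refine ⟨fun h _ _ _ _ _ _ _ n Θ => hodgeConjectureFor_cmProdAV_of_hc_cm h h₃ n Θ, fun h => ?_⟩
  refine (hc_cm_iff_forall_galois_cmProdAV_over F₀ h₃).2 fun F _ _ _ hG h0 n Θ => ?_
  by_cases h8 : 8 ≤ Module.finrank ℚ F
  · exact h F hG h0 h8 n Θ
  · haveI := hG
    exact hodgeConjectureFor_cmProdAV_of_isGalois_of_finrank_lt_eight_of_markman hW4 (by omega) h₃ n Θ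

/-! ## §5 The record-free readings (at the tree's realisation theorem `cmAbelianVarietyRealised_holds`) -/

/-- **`HC_CM` ⟺ its Galois slices of degree `≥ 8` over the tree's realisation record, given Markman's fourfold
theorem** (`hc_cm_iff_forall_galois_cmProdAV_eight_le_of_markman` at `cmAbelianVarietyRealised_holds`).
[cite: Milne2020HodgeClassesAV, proof of Theorem 1] [cite: Markman2025SurveySecant, Thm. 1.2] -/
theorem hc_cm_iff_forall_galois_cmProdAV_eight_le_of_markman_rec
    (hW4 : Markman2025_weilClasses_algebraic_abelianFourfold) :
    HC_CM ↔ ∀ (F : Type) [Field F] [NumberField F] [IsCMField F], IsGalois ℚ F → 8 ≤ Module.finrank ℚ F →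
      ∀ (n : ℕ) (Θ : Fin (n + 1) → CMType F),
        HodgeConjectureFor (cmProdAV F cmAbelianVarietyRealised_holds n Θ).dim
          (cmProdAV F cmAbelianVarietyRealised_holds n Θ).X :=
  hc_cm_iff_forall_galois_cmProdAV_eight_le_of_markman hW4 cmAbelianVarietyRealised_holds

/-- **… and with the dimension cut**: `HC_CM ⟺` HC for the products of dimension `≥ 6` over the Galois CM fields of
degree `≥ 8`, over the tree's realisation record, given Markman's fourfold theorem.
[cite: MoonenZarhin1999LowDim, Thms. (0.1)–(0.2)] [cite: Markman2025SurveySecant, Thm. 1.2 and Cor. 1.3] -/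
theorem hc_cm_iff_forall_galois_cmProdAV_eight_le_six_le_dim_of_markman_rec
    (hW4 : Markman2025_weilClasses_algebraic_abelianFourfold) :
    HC_CM ↔ ∀ (F : Type) [Field F] [NumberField F] [IsCMField F], IsGalois ℚ F → 8 ≤ Module.finrank ℚ F →
      ∀ (n : ℕ) (Θ : Fin (n + 1) → CMType F), 6 ≤ (cmProdAV F cmAbelianVarietyRealised_holds n Θ).dim →
        HodgeConjectureFor (cmProdAV F cmAbelianVarietyRealised_holds n Θ).dim
          (cmProdAV F cmAbelianVarietyRealised_holds n Θ).X :=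
  hc_cm_iff_forall_galois_cmProdAV_eight_le_six_le_dim_of_markman hW4 cmAbelianVarietyRealised_holds

end Summit.HodgeConjecture.CorCM.SliceExhaustion

end
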